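import Mathlib.NumberTheory.Padics.WithVal
import Mathlib.Topology.Algebra.Valued.NormedValued
import Literature.NumberTheory.EllipticCurves.CanonicalPAdicHeightProofs
import Literature.NumberTheory.EllipticCurves.PAdicHeightsLogProofs
import Literature.NumberTheory.EllipticCurves.ReductionHomomorphism
import HarnessLib

/-!
# The canonical `p`-adic height: the admissible locus is a subgroup, `σ_p ≠ 0` on `E₁`, and the
# parallelogram law of the sigma formula from the theta relation and Néron's local law

Trunk T-NT-EC (Literature/NumberTheory/EllipticCurves); second proof file behind the named fact
`WeierstrassCurve.exists_isCanonical` of `CanonicalPAdicHeight.lean` (existence of the canonical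
cyclotomic `p`-adic height datum whose quadratic form on admissible points is the sigma formula
`ĥ_p(P) = log_p(den x(P)) - 2 log_p σ_p(z(P))`, Stein–Wuthrich 2013 §4.1 (4.1) = `-2p ×`
Mazur–Stein–Tate 2006 (1.1)). `CanonicalPAdicHeightProofs.lean` proved the algebraic half and
reduced `exists_isCanonical` to three named facts (`exists_isCanonical_of_parallelogram`):
(1) `localConditionsLocus_isAddSubgroup`, (2) `not_isOfFinAddOrder_of_one_lt_padicNorm`,
(3) `canonicalPAdicHeight_parallelogram`, with (3) resting on `padicSigma_theta` and
`padicValNat_den_parallelogram`. This file PROVES (1) for odd `p` and PROVES (3) from its printed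
inputs (the multiplicativity of the Iwasawa logarithm being the tree's THEOREM
`padicLog_mul_holds`, `PAdicHeightsLogProofs.lean`), so that after it

  `exists_isCanonical ⟸ not_isOfFinAddOrder_of_one_lt_padicNorm (AEC IV.6.1)
   + padicSigma_theta (Mazur–Tate 1991) + padicValNat_den_parallelogram (ATAEC VI.4.1, Ex. 6.3)`
  (`exists_isCanonical_of_theta`),

all three being named facts stated in `CanonicalPAdicHeightProofs.lean`; nothing new is asserted
here.

## Contents (all proved)

* `Literature.NumberTheory.EllipticCurves.ratAdicValuation ℓ`, `localIntegers ℓ` — the `ℓ`-adic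
  absolute value of `ℚ` as a `Valuation ℚ ℝ≥0` (pull-back of the norm valuation of `ℚ_ℓ`) and its
  valuation ring `ℤ_(ℓ) ⊂ ℚ`, with `integers_localIntegers` (= Mathlib's
  `Valuation.valuationSubring.integers`), the hypothesis `hv` under which
  `ReductionHomomorphism.lean` (AEC VII.2.1 for an arbitrary valuation ring) applies with `K = ℚ`.
  Mathlib has the `ℤᵐ⁰`-valued `Rat.padicValuation ℓ` with the SAME valuation ring
  (`localIntegers_eq_padicValuation_valuationSubring`); the `ℝ≥0`-valued pull-back is kept because
  (i) `ratAdicValuation ℓ q = ‖q‖_ℓ` holds by `rfl`, which is how every estimate here is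
  transported to the `p`-adic norms in the statements of `CanonicalPAdicHeight.lean`, and
  (ii) `GoodReductionInertia.lean` (torsion via division polynomials) is stated for
  `Valuation L ℝ≥0`;
* `WeierstrassCurve.localModel W ℓ` — a `ℤ`-integral equation `W/ℚ` regarded over `ℤ_(ℓ)`; its base
  change to `ℚ` is `W` by `rfl`, so rational points ARE points of the local model and no transport
  is needed; `IsGloballyMinimal.isIntegral_int` (a globally minimal `W/ℚ` is `ℤ`-integral);
* the dictionary with the coordinate predicates of `CanonicalPAdicHeight.lean`:
  `hasNonsingularReduction_localModel_iff` (`E₀` at `ℓ` = `HasNonsingularReductionAt ℓ x y`) and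
  `reducesToZero_localModel_iff` (`E₁` at `p` = `‖x‖_p > 1`); the subgroups
  `nonsingularReductionSubgroupAt W ℓ`, `kernelOfReductionAt W p` of `E(ℚ)` (AEC VII.2.1–2.2, from
  `HasNonsingularReduction.add/.neg`, `ReducesToZero.add/.neg` of `ReductionHomomorphism.lean`);
* `inSigmaDisc_of_one_lt_norm` — for `p` odd, `P ∈ E₁(ℚ_p)` has `‖z(P)‖ ≤ p⁻¹ < p^{-1/(p-1)}`
  (AEC VII.2.2: `3v(x) = 2v(y)`), and `exists_addSubgroup_coe_eq_localConditionsLocus` — **the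
  admissible locus with `O` is the subgroup `E₁ at p ⊓ ⨅_ℓ E₀ at ℓ`** for every `ℤ`-integral `W`
  and every prime `p ≠ 2`: the named fact `localConditionsLocus_isAddSubgroup` for odd `p`;
* `norm_padicSigmaEval_sub_lt`, `padicSigmaEval_ne_zero`, `padicSigmaAt_ne_zero` — `σ_p ∈ t + t²ℤ_p⟦t⟧`
  unconditionally (Mazur–Tate pair or junk value `t`), so `‖σ_p(t) - t‖ < ‖t‖` on the punctured
  unit disc and **`σ_p(P) ≠ 0` for `P ∈ E(ℚ) ∩ E₁(ℚ_p)`** (MST 2006 §2.3: `σ_v : E₁(K_v) → K_v^*`);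
* `den_mul_den_eq` — the GLOBAL denominator identity
  `den x(P+Q) · den x(P-Q) = den x(P)² den x(Q)² (x(P) - x(Q))²` for a generic pair reducing
  non-singularly everywhere, from the local law `padicValNat_den_parallelogram` at every prime
  (a positive rational is determined by its valuations, `Nat.eq_iff_prime_padicValNat_eq`);
* `padicLog_one/_neg_one/_neg/_sq` — `log_p(-1) = 0` etc., from the tree's theorem
  `padicLog_mul_holds` (`PAdicHeightsLogProofs.lean`);
* `canonicalPAdicHeight_parallelogram_of_theta` — **the parallelogram law of the sigma formula on
  generic admissible pairs** (the named fact `canonicalPAdicHeight_parallelogram`) from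
  `padicSigma_theta` and `padicValNat_den_parallelogram`: with `dᵢ = den x(Pᵢ)`,
  `σᵢ = σ_p(Pᵢ)` (`P₃ = P + Q`, `P₄ = P - Q`), `δ = x(P) - x(Q)`, one has `d₃d₄ = d₁²d₂²δ²` and
  `σ₃σ₄ = -δσ₁²σ₂²`, whence `ĥ(P+Q) + ĥ(P-Q) = log_p(d₃d₄) - 2 log_p(σ₃σ₄) = 2ĥ(P) + 2ĥ(Q)`;
* `exists_isCanonical_of_theta`, `existsUnique_isCanonical_of_theta` — the assembly.

## Sources (read)

* B. Mazur, W. Stein, J. Tate, *Computation of `p`-adic heights and log convergence*, Doc. Math.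
  Extra Vol. Coates (2006): §1 pp. 2–3 (eq. (1.1) `h_p(P) = p⁻¹ log_p(σ(P)/d(P))`, "extends
  uniquely", Thm. 1.3 `σ(t) = t + ⋯ ∈ tℤ_p⟦t⟧`), §2.3 (`σ_v : E₁(K_v) → K_v^*`), §2.6 (sum over all
  places), §2.7 ("`h_ρ` is quadratic because of property IV of `σ` in [MT91]").
* J. H. Silverman, *AEC* (2nd ed.), VII.2 Prop. 2.1, 2.2 (held copy, PDF pp. 166–170), IV.6.4;
  *ATAEC*, VI.4.1, Ex. 6.3 (as cited by the named fact `padicValNat_den_parallelogram`).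
* W. Stein, C. Wuthrich, Math. Comp. 82 (2013), §4.1 eq. (4.1) (normalisation; §4: range of
  convergence `ord_p(t) > 1/(p-1)` of `σ`).

## Design notes

* `ReductionHomomorphism.lean` is elaborated for a general field with the classical `DecidableEq`
  instance, whereas the group law on `E(ℚ)` uses `Rat`'s; the two additions agree
  (`Literature.NumberTheory.EllipticCurves.point_add_irrel`, by `Subsingleton.elim`) and the
  subgroups of `E(ℚ)` are rebuilt from the closure theorems rather than transported.
* The locus theorem needs `p ≠ 2` only for the sigma-disc clause (for `p = 2` the disc is
  `E₂(ℚ₂)`, whose closure under `+` is not in the tree); everything else holds for all `p` and for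
  every `ℤ`-integral (not necessarily minimal) equation. The assembly uses `p ≥ 5`.
* Still named facts after this file (the trust base of `exists_isCanonical_of_theta`): THREE —
  `not_isOfFinAddOrder_of_one_lt_padicNorm`, `padicSigma_theta`, `padicValNat_den_parallelogram`
  (the generic form of the last is the theorem `max_v_addX_mul_max_v_addX_neg_mul_v_sub_sq` of
  `LocalDenominatorLaw.lean`; its `ℚ`-specialisation and the torsion statement are discharged in the
  sibling `CanonicalPAdicHeightLeavesProofs.lean`, which imports this file).
* The instance `IsGloballyMinimal.isIntegral_int` (a globally minimal `W/ℚ` is `ℤ`-integral) is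
  what lets the `IsIntegral ℤ`-hypothesised facts (`padicValNat_den_parallelogram`) be used under
  the `IsGloballyMinimal` hypotheses of the others; it would sit equally well next to
  `integralModelInt` in `GlobalMinimalModel.lean`.
-/

noncomputable section

open scoped Classical NNReal

namespace Literature.NumberTheory.EllipticCurves

/-! ### The `ℓ`-adic valuation ring of `ℚ` -/

section LocalIntegers

variable (ℓ : ℕ) [Fact ℓ.Prime]

/-- The `ℓ`-adic absolute value of `ℚ` as a (norm-like, multiplicative) valuation with values in
`ℝ≥0`: `q ↦ ‖q‖_ℓ`, the pull-back of the norm valuation of `ℚ_ℓ` along `ℚ → ℚ_ℓ`. [folklore] -/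
def ratAdicValuation : Valuation ℚ ℝ≥0 :=
  NormedField.valuation.comap (Rat.castHom ℚ_[ℓ])

/-- `ratAdicValuation ℓ q = ‖q‖_ℓ`. [folklore] -/
@[simp] theorem ratAdicValuation_apply (q : ℚ) : ratAdicValuation ℓ q = ‖(q : ℚ_[ℓ])‖₊ := rfl

/-- The valuation ring `ℤ_(ℓ) = {q ∈ ℚ | ‖q‖_ℓ ≤ 1}` of `ℚ` at `ℓ`, as a valuation subring (a local
ring with fraction field `ℚ`). [Silverman AEC VII.1–VII.2 (the local ring `R` of a discrete
valuation)] [folklore] -/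
def localIntegers : ValuationSubring ℚ :=
  (ratAdicValuation ℓ).valuationSubring

/-- `q ∈ ℤ_(ℓ) ↔ ‖q‖_ℓ ≤ 1`. [folklore] -/
theorem mem_localIntegers_iff (q : ℚ) : q ∈ localIntegers ℓ ↔ ‖(q : ℚ_[ℓ])‖ ≤ 1 := by
  rw [localIntegers, Valuation.mem_valuationSubring_iff, ← NNReal.coe_le_coe]; rfl

/-- `ℤ_(ℓ)` is the ring of integers of the `ℓ`-adic valuation of `ℚ` (the hypothesis `hv` of
`ReductionHomomorphism.lean`); an alias of Mathlib's `Valuation.valuationSubring.integers`.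
[folklore] -/
theorem integers_localIntegers : (ratAdicValuation ℓ).Integers (localIntegers ℓ) :=
  Valuation.valuationSubring.integers _

/-- **Glue with Mathlib's `ℤᵐ⁰`-valued `p`-adic valuation of `ℚ`**: the valuation ring `ℤ_(ℓ)`
of `ratAdicValuation ℓ` is that of `Rat.padicValuation ℓ` (the two valuations are equivalent;
Mathlib `Padic.norm_rat_le_one_iff_padicValuation_le_one`). [folklore] -/
theorem localIntegers_eq_padicValuation_valuationSubring :
    localIntegers ℓ = (Rat.padicValuation ℓ).valuationSubring := by
  ext q
  rw [mem_localIntegers_iff, Valuation.mem_valuationSubring_iff,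
    Padic.norm_rat_le_one_iff_padicValuation_le_one]

/-- Integers lie in `ℤ_(ℓ)`. [folklore] -/
theorem intCast_mem_localIntegers (n : ℤ) : (n : ℚ) ∈ localIntegers ℓ := by
  rw [mem_localIntegers_iff]; simpa using Padic.norm_int_le_one n

/-- `q ∉ ℤ_(ℓ) ↔ 1 < ‖q‖_ℓ`. [folklore] -/
theorem not_mem_localIntegers_iff (q : ℚ) : q ∉ localIntegers ℓ ↔ 1 < ‖(q : ℚ_[ℓ])‖ := by
  rw [mem_localIntegers_iff, not_le]

/-- `‖x‖_ℓ > 1 ↔ ord_ℓ x < 0` for `x ∈ ℚ`. [folklore] -/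
theorem one_lt_norm_ratCast_iff (x : ℚ) : 1 < ‖(x : ℚ_[ℓ])‖ ↔ padicValRat ℓ x < 0 := by
  rcases eq_or_ne x 0 with rfl | hx
  · simp
  · have hp : (1 : ℚ) < ℓ := by exact_mod_cast (Fact.out : ℓ.Prime).one_lt
    rw [Padic.eq_padicNorm, show (1 : ℝ) = ((1 : ℚ) : ℝ) by norm_num, Rat.cast_lt,
      padicNorm.eq_zpow_of_nonzero hx, one_lt_zpow_iff_right₀ hp, neg_pos]

/-- `‖a‖_ℓ = 1 ↔ a ≠ 0 ∧ ord_ℓ a = 0` for `a ∈ ℚ`. [folklore] -/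
theorem norm_ratCast_eq_one_iff (a : ℚ) : ‖(a : ℚ_[ℓ])‖ = 1 ↔ a ≠ 0 ∧ padicValRat ℓ a = 0 := by
  rcases eq_or_ne a 0 with rfl | ha
  · simp
  · have hp : (1 : ℚ) < ℓ := by exact_mod_cast (Fact.out : ℓ.Prime).one_lt
    rw [Padic.eq_padicNorm, show (1 : ℝ) = ((1 : ℚ) : ℝ) by norm_num, Rat.cast_inj,
      padicNorm.eq_zpow_of_nonzero ha, zpow_eq_one_iff_right₀ (by positivity) hp.ne', neg_eq_zero]
    simp [ha]

end LocalIntegers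

/-- Decidability-irrelevance of the group law: Mathlib's addition on `V.toAffine.Point` takes a
`DecidableEq` instance on the field, and any two give the same sum (needed to specialise
`ReductionHomomorphism.lean`, elaborated with the classical instance, to `ℚ`). [folklore] -/
theorem point_add_irrel {F : Type*} [Field F] {V : WeierstrassCurve F} (d₁ d₂ : DecidableEq F)
    (P Q : V.toAffine.Point) :
    @HAdd.hAdd _ _ _ (@instHAdd _ (@WeierstrassCurve.Affine.Point.instAdd F _ V.toAffine d₁)) P Q =
      @HAdd.hAdd _ _ _ (@instHAdd _ (@WeierstrassCurve.Affine.Point.instAdd F _ V.toAffine d₂)) P Q := by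
  have : d₁ = d₂ := Subsingleton.elim _ _
  subst this; rfl

end Literature.NumberTheory.EllipticCurves

namespace WeierstrassCurve

open Literature.NumberTheory.EllipticCurves

/-! ### Local models of a `ℤ`-integral equation over `ℚ` -/

section LocalModel

variable (ℓ : ℕ) [Fact ℓ.Prime] (W : WeierstrassCurve ℚ)

/-- A globally minimal equation over `ℚ` has coefficients in `ℤ` (Mathlib's `IsIntegral ℤ`), via
`integralModelInt`. [Silverman AEC VIII.8] [folklore] -/
instance IsGloballyMinimal.isIntegral_int [W.IsGloballyMinimal] : W.IsIntegral ℤ :=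
  ⟨⟨integralModelInt W, by rw [baseChange, algebraMap_int_eq, map_integralModelInt]⟩⟩

variable [W.IsIntegral ℤ]

/-- The coefficients of a `ℤ`-integral equation lie in every `ℤ_(ℓ)`. [folklore] -/
theorem a₁_mem_localIntegers : W.a₁ ∈ localIntegers ℓ := by
  rw [← integralModel_a₁_eq ℤ W]; exact intCast_mem_localIntegers ℓ _

/-- The coefficients of a `ℤ`-integral equation lie in every `ℤ_(ℓ)`. [folklore] -/
theorem a₂_mem_localIntegers : W.a₂ ∈ localIntegers ℓ := by
  rw [← integralModel_a₂_eq ℤ W]; exact intCast_mem_localIntegers ℓ _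

/-- The coefficients of a `ℤ`-integral equation lie in every `ℤ_(ℓ)`. [folklore] -/
theorem a₃_mem_localIntegers : W.a₃ ∈ localIntegers ℓ := by
  rw [← integralModel_a₃_eq ℤ W]; exact intCast_mem_localIntegers ℓ _

/-- The coefficients of a `ℤ`-integral equation lie in every `ℤ_(ℓ)`. [folklore] -/
theorem a₄_mem_localIntegers : W.a₄ ∈ localIntegers ℓ := by
  rw [← integralModel_a₄_eq ℤ W]; exact intCast_mem_localIntegers ℓ _

/-- The coefficients of a `ℤ`-integral equation lie in every `ℤ_(ℓ)`. [folklore] -/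
theorem a₆_mem_localIntegers : W.a₆ ∈ localIntegers ℓ := by
  rw [← integralModel_a₆_eq ℤ W]; exact intCast_mem_localIntegers ℓ _

/-- **The local model at `ℓ`**: the same equation, with coefficients regarded in `ℤ_(ℓ)` (so that
`ReductionHomomorphism.lean` applies with `R = ℤ_(ℓ)`, `K = ℚ`); its base change to `ℚ` is `W`
definitionally. [Silverman AEC VII.1–VII.2] [folklore] -/
def localModel : WeierstrassCurve (localIntegers ℓ) :=
  ⟨⟨W.a₁, W.a₁_mem_localIntegers ℓ⟩, ⟨W.a₂, W.a₂_mem_localIntegers ℓ⟩,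
    ⟨W.a₃, W.a₃_mem_localIntegers ℓ⟩, ⟨W.a₄, W.a₄_mem_localIntegers ℓ⟩,
    ⟨W.a₆, W.a₆_mem_localIntegers ℓ⟩⟩

/-- The local model is a model: `(W.localModel ℓ) ⊗ ℚ = W` (by `rfl`). [folklore] -/
theorem baseChange_localModel : (W.localModel ℓ).baseChange ℚ = W := rfl

end LocalModel

/-! ### `E₀` and `E₁` at a prime, for rational points, via the local model -/

section AtPrime

variable (W : WeierstrassCurve ℚ) [W.IsIntegral ℤ] (ℓ : ℕ) [Fact ℓ.Prime]

variable {W ℓ} in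
/-- **`E₀` at `ℓ` in coordinates.** For a `ℤ`-integral equation, a rational point `(x, y)` has
non-singular reduction modulo `ℓ` in the sense of `ReductionHomomorphism.lean` (for the local model
over `ℤ_(ℓ)`) iff `HasNonsingularReductionAt ℓ x y` (`ord_ℓ x < 0`, or `Φ_x` or `Φ_y` an `ℓ`-adic
unit). [Silverman AEC VII.2 (definition of `E₀`)] [folklore] -/
theorem hasNonsingularReduction_localModel_iff {x y : ℚ} (h : W.toAffine.Nonsingular x y) :
    HasNonsingularReduction (W.localModel ℓ) (.some x y h) ↔ W.HasNonsingularReductionAt ℓ x y := by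
  have hv := integers_localIntegers ℓ
  have hinj : Function.Injective (algebraMap (localIntegers ℓ) ℚ) := hv.hom_inj
  -- dictionary between residues / valuations and `ℓ`-adic norms
  have hunit : ∀ a : localIntegers ℓ, IsLocalRing.residue (localIntegers ℓ) a ≠ 0 ↔
      ‖((algebraMap (localIntegers ℓ) ℚ a : ℚ) : ℚ_[ℓ])‖ = 1 := fun a => by
    rw [← Literature.NumberTheory.EllipticCurves.v_algebraMap_eq_one_iff hv, ratAdicValuation_apply,
      ← NNReal.coe_eq_one, coe_nnnorm]
  have hout : x ∉ Set.range (algebraMap (localIntegers ℓ) ℚ) ↔ padicValRat ℓ x < 0 := by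
    rw [Literature.NumberTheory.EllipticCurves.not_mem_range_iff hv, ratAdicValuation_apply,
      ← NNReal.coe_lt_coe, NNReal.coe_one, coe_nnnorm, one_lt_norm_ratCast_iff]
  have ha₁ : algebraMap (localIntegers ℓ) ℚ (W.localModel ℓ).a₁ = W.a₁ := rfl
  have ha₂ : algebraMap (localIntegers ℓ) ℚ (W.localModel ℓ).a₂ = W.a₂ := rfl
  have ha₃ : algebraMap (localIntegers ℓ) ℚ (W.localModel ℓ).a₃ = W.a₃ := rfl
  have ha₄ : algebraMap (localIntegers ℓ) ℚ (W.localModel ℓ).a₄ = W.a₄ := rfl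
  -- the two non-singularity conditions agree on integral points
  have key : ∀ x₀ y₀ : localIntegers ℓ,
      ((W.localModel ℓ).map (IsLocalRing.residue _)).toAffine.polynomialX.evalEval
          (IsLocalRing.residue _ x₀) (IsLocalRing.residue _ y₀) ≠ 0 ∨
        ((W.localModel ℓ).map (IsLocalRing.residue _)).toAffine.polynomialY.evalEval
          (IsLocalRing.residue _ x₀) (IsLocalRing.residue _ y₀) ≠ 0 ↔
      (W.toAffine.polynomialX.evalEval (algebraMap _ ℚ x₀) (algebraMap _ ℚ y₀) ≠ 0 ∧
          padicValRat ℓ (W.toAffine.polynomialX.evalEval (algebraMap _ ℚ x₀) (algebraMap _ ℚ y₀)) = 0) ∨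
        (W.toAffine.polynomialY.evalEval (algebraMap _ ℚ x₀) (algebraMap _ ℚ y₀) ≠ 0 ∧
          padicValRat ℓ (W.toAffine.polynomialY.evalEval (algebraMap _ ℚ x₀) (algebraMap _ ℚ y₀)) = 0) := by
    intro x₀ y₀
    have hΦx : algebraMap (localIntegers ℓ) ℚ (3 * x₀ ^ 2 + 2 * (W.localModel ℓ).a₂ * x₀ +
        (W.localModel ℓ).a₄ - (W.localModel ℓ).a₁ * y₀) =
          -(W.toAffine.polynomialX.evalEval (algebraMap _ ℚ x₀) (algebraMap _ ℚ y₀)) := by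
      rw [WeierstrassCurve.Affine.evalEval_polynomialX]
      simp only [map_sub, map_add, map_mul, map_pow, map_ofNat, ha₁, ha₂, ha₄]
      ring
    have hΦy : algebraMap (localIntegers ℓ) ℚ (y₀ - (W.localModel ℓ).toAffine.negY x₀ y₀) =
        W.toAffine.polynomialY.evalEval (algebraMap _ ℚ x₀) (algebraMap _ ℚ y₀) := by
      rw [WeierstrassCurve.Affine.evalEval_polynomialY, WeierstrassCurve.Affine.negY]
      simp only [map_sub, map_neg, map_mul, ha₁, ha₃]
      ring
    have ex := Literature.NumberTheory.EllipticCurves.residue_polynomialX (W := W.localModel ℓ) x₀ y₀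
    have ey := Literature.NumberTheory.EllipticCurves.residue_polynomialY (W := W.localModel ℓ) x₀ y₀
    have kx : ((W.localModel ℓ).map (IsLocalRing.residue _)).toAffine.polynomialX.evalEval
          (IsLocalRing.residue _ x₀) (IsLocalRing.residue _ y₀) ≠ 0 ↔
        (W.toAffine.polynomialX.evalEval (algebraMap _ ℚ x₀) (algebraMap _ ℚ y₀) ≠ 0 ∧
          padicValRat ℓ (W.toAffine.polynomialX.evalEval (algebraMap _ ℚ x₀) (algebraMap _ ℚ y₀)) = 0) := by
      rw [← neg_ne_zero, ← ex, hunit, hΦx, Rat.cast_neg, norm_neg, norm_ratCast_eq_one_iff]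
    have ky : ((W.localModel ℓ).map (IsLocalRing.residue _)).toAffine.polynomialY.evalEval
          (IsLocalRing.residue _ x₀) (IsLocalRing.residue _ y₀) ≠ 0 ↔
        (W.toAffine.polynomialY.evalEval (algebraMap _ ℚ x₀) (algebraMap _ ℚ y₀) ≠ 0 ∧
          padicValRat ℓ (W.toAffine.polynomialY.evalEval (algebraMap _ ℚ x₀) (algebraMap _ ℚ y₀)) = 0) := by
      rw [← ey, hunit, hΦy, norm_ratCast_eq_one_iff]
    rw [kx, ky]
  constructor
  · rintro (hx | ⟨x₀, y₀, rfl, rfl, hns⟩)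
    · exact Or.inl (hout.mp hx)
    · exact Or.inr ((key x₀ y₀).mp hns.2)
  · intro hxy
    by_cases hx : x ∈ Set.range (algebraMap (localIntegers ℓ) ℚ)
    · obtain ⟨x₀, rfl⟩ := hx
      have h1 : ((W.localModel ℓ).baseChange ℚ).toAffine.Equation (algebraMap _ ℚ x₀) y := h.1
      have hy : ratAdicValuation ℓ y ≤ 1 :=
        Literature.NumberTheory.EllipticCurves.v_Y_le_one_of_v_X_le_one hv h1 (hv.map_le_one x₀)
      obtain ⟨y₀, rfl⟩ := hv.exists_of_le_one hy
      have h2 : (W.localModel ℓ).toAffine.Equation x₀ y₀ :=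
        (Literature.NumberTheory.EllipticCurves.map_equation_iff (W := W.localModel ℓ) hinj).mp h1
      refine Or.inr ⟨x₀, y₀, rfl, rfl, h2.map _, (key x₀ y₀).mpr (hxy.resolve_left fun hlt => ?_)⟩
      exact (hout.mpr hlt) ⟨x₀, rfl⟩
    · exact Or.inl hx

variable {W ℓ} in
/-- **`E₁` at `p` in coordinates**: `(x, y)` reduces to `Õ` modulo `p` iff `‖x‖_p > 1`.
[Silverman AEC VII.2 (definition of `E₁`)] [folklore] -/
theorem reducesToZero_localModel_iff {x y : ℚ} (h : W.toAffine.Nonsingular x y) :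
    ReducesToZero (W.localModel ℓ) (.some x y h) ↔ 1 < ‖(x : ℚ_[ℓ])‖ := by
  rw [reducesToZero_some_iff]
  exact (Literature.NumberTheory.EllipticCurves.not_mem_range_iff (integers_localIntegers ℓ)).trans
    (by rw [ratAdicValuation_apply, ← NNReal.coe_lt_coe]; rfl)

/-- **`E₀(ℚ) at ℓ` as a subgroup of `E(ℚ)`**: the rational points with non-singular reduction
modulo `ℓ`, rebuilt from the closure theorems `HasNonsingularReduction.add/.neg` of
`ReductionHomomorphism.lean` for the local model (AEC VII.2.1; same underlying set as
`nonsingularReductionSubgroup (W.localModel ℓ) hv` there and, for a minimal equation, as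
`goodReductionSubgroup` of `Tamagawa.lean`, but over the `Rat` instances of `E(ℚ)`).
[Silverman AEC VII.2.1] [cite: SilvermanAEC2009, VII.2.1] -/
def nonsingularReductionSubgroupAt : AddSubgroup W.toAffine.Point where
  carrier := {P | HasNonsingularReduction (W.localModel ℓ) P}
  zero_mem' := (hasNonsingularReduction_zero : HasNonsingularReduction (K := ℚ) (W.localModel ℓ) 0)
  add_mem' {P Q} hP hQ := by
    have := HasNonsingularReduction.add (integers_localIntegers ℓ) hP hQ
    show HasNonsingularReduction (K := ℚ) (W.localModel ℓ) (P + Q)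
    convert this using 2
    exact point_add_irrel _ _ P Q
  neg_mem' {P} hP := HasNonsingularReduction.neg hP

/-- **`E₁(ℚ_p) ∩ E(ℚ)` as a subgroup of `E(ℚ)`**: the rational points reducing to `Õ` modulo `p`,
rebuilt from `ReducesToZero.add/.neg` of `ReductionHomomorphism.lean` for the local model
(AEC VII.2.1–2.2; same underlying set as `kernelOfReduction (W.localModel p) hv` there).
[Silverman AEC VII.2.2] [cite: SilvermanAEC2009, VII.2.2] -/
def kernelOfReductionAt : AddSubgroup W.toAffine.Point where
  carrier := {P | ReducesToZero (W.localModel ℓ) P}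
  zero_mem' := (reducesToZero_zero : ReducesToZero (K := ℚ) (W.localModel ℓ) 0)
  add_mem' {P Q} hP hQ := by
    have := ReducesToZero.add (integers_localIntegers ℓ) hP hQ
    show ReducesToZero (K := ℚ) (W.localModel ℓ) (P + Q)
    convert this using 2
    exact point_add_irrel _ _ P Q
  neg_mem' {P} hP := ReducesToZero.neg hP

variable {W ℓ}

/-- Membership in `E₀(ℚ) at ℓ` is `ReducesNonsingularlyAt`. [folklore] -/
theorem mem_nonsingularReductionSubgroupAt_iff (P : W.toAffine.Point) :
    P ∈ W.nonsingularReductionSubgroupAt ℓ ↔ W.ReducesNonsingularlyAt ℓ P := by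
  change HasNonsingularReduction (K := ℚ) (W.localModel ℓ) P ↔ _
  rcases P with _ | ⟨x, y, h⟩
  · exact ⟨fun _ => trivial, fun _ => hasNonsingularReduction_zero⟩
  · exact hasNonsingularReduction_localModel_iff h

/-- Membership of an affine point in the kernel of reduction at `p`. [folklore] -/
theorem some_mem_kernelOfReductionAt_iff {x y : ℚ} (h : W.toAffine.Nonsingular x y) :
    (.some x y h : W.toAffine.Point) ∈ W.kernelOfReductionAt ℓ ↔ 1 < ‖(x : ℚ_[ℓ])‖ := by
  change ReducesToZero (K := ℚ) (W.localModel ℓ) (.some x y h) ↔ _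
  exact reducesToZero_localModel_iff h

end AtPrime

/-! ### The admissible locus (with `O`) is a subgroup, for `p` odd -/

section Locus

variable (W : WeierstrassCurve ℚ) [W.IsIntegral ℤ] (p : ℕ) [Fact p.Prime]

variable {W p} in
/-- **Points of `E₁(ℚ_p)` have parameter in the sigma disc when `p` is odd**: for a `ℤ`-integral
equation and `P = (x, y) ∈ E(ℚ)` with `‖x‖_p > 1` one has `y ≠ 0`, `‖z(P)‖_p = ‖x/y‖_p < 1`
(AEC VII.2.2: `3v(x) = 2v(y)`), hence `‖z(P)‖ ≤ p⁻¹ < p^{-1/(p-1)}` as soon as `p > 2`.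
[Silverman AEC VII.2.2, IV.6.4; Stein–Wuthrich 2013, §4 (range of convergence of `σ`)] [folklore] -/
theorem inSigmaDisc_of_one_lt_norm (hp : p ≠ 2) {x y : ℚ} (h : W.toAffine.Nonsingular x y)
    (hx : 1 < ‖(x : ℚ_[p])‖) : (y : ℚ_[p]) ≠ 0 ∧ InSigmaDisc p (-(x : ℚ_[p]) / y) := by
  have hv := integers_localIntegers p
  have h1 : ((W.localModel p).baseChange ℚ).toAffine.Equation x y := h.1
  have hx' : 1 < ratAdicValuation p x := by
    rw [ratAdicValuation_apply, ← NNReal.coe_lt_coe, NNReal.coe_one, coe_nnnorm]; exact hx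
  obtain ⟨hy, hz, -, -, -⟩ := Literature.NumberTheory.EllipticCurves.v_zw_of_one_lt hv h1 hx'
  rw [ratAdicValuation_apply, ← NNReal.coe_lt_coe, NNReal.coe_one, coe_nnnorm, Rat.cast_div,
    Rat.cast_neg] at hz
  have hy' : (y : ℚ_[p]) ≠ 0 := by exact_mod_cast hy
  refine ⟨hy', ?_⟩
  unfold InSigmaDisc
  have hp1 : (1 : ℝ) < p := by exact_mod_cast (Fact.out : p.Prime).one_lt
  have hp2 : (2 : ℝ) < p := by
    have h2 : 2 < p := lt_of_le_of_ne (Fact.out : p.Prime).two_le (Ne.symm hp)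
    exact_mod_cast h2
  -- `p⁻¹ < p^{-1/(p-1)}`
  have hlt : (p : ℝ)⁻¹ < (p : ℝ) ^ (-(1 / ((p : ℝ) - 1))) := by
    rw [← Real.rpow_neg_one, Real.rpow_lt_rpow_left_iff hp1, neg_lt_neg_iff,
      div_lt_one (by linarith)]
    linarith
  refine lt_of_le_of_lt ?_ hlt
  -- `‖z‖ ≤ p⁻¹` since `‖z‖ < 1` is an integral power of `p`
  by_cases hz0 : -(x : ℚ_[p]) / y = 0
  · rw [hz0, norm_zero]; positivity
  · rw [Padic.norm_eq_zpow_neg_valuation hz0] at hz ⊢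
    have hval : 0 < (-(x : ℚ_[p]) / y).valuation := by
      by_contra hle
      exact (one_le_zpow₀ hp1.le (by omega)).not_gt hz
    calc (p : ℝ) ^ (-(-(x : ℚ_[p]) / y).valuation) ≤ (p : ℝ) ^ (-1 : ℤ) :=
          zpow_le_zpow_right₀ hp1.le (by omega)
      _ = (p : ℝ)⁻¹ := zpow_neg_one _

/-- **The admissible locus with `O` is a subgroup of `E(ℚ)` (`p` odd).** For a `ℤ`-integral
equation `W/ℚ` and a prime `p ≠ 2`, `{O} ∪ {P | SatisfiesLocalConditions p P}` is the underlying
set of the subgroup `E₁ at p ⊓ ⨅_ℓ E₀ at ℓ` (AEC VII.2.1–2.2 through the local models; the sigma-disc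
condition is implied by `P ∈ E₁(ℚ_p)` for odd `p`, `inSigmaDisc_of_one_lt_norm`). This is the
named fact `localConditionsLocus_isAddSubgroup` of `CanonicalPAdicHeightProofs.lean` for `p ≠ 2`
(and for every `ℤ`-integral, not necessarily minimal, equation).
[Silverman AEC VII.2.1, VII.2.2] [cite: SilvermanAEC2009, VII.2.1] -/
theorem exists_addSubgroup_coe_eq_localConditionsLocus (hp : p ≠ 2) :
    ∃ H : AddSubgroup W.toAffine.Point, (H : Set W.toAffine.Point) = W.localConditionsLocus p := by
  refine ⟨W.kernelOfReductionAt p ⊓ ⨅ ℓ : Nat.Primes,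
    (haveI : Fact ℓ.1.Prime := ⟨ℓ.2⟩; W.nonsingularReductionSubgroupAt ℓ.1), ?_⟩
  ext P
  rw [SetLike.mem_coe, AddSubgroup.mem_inf, AddSubgroup.mem_iInf, mem_localConditionsLocus_iff]
  rcases P with _ | ⟨x, y, h⟩
  · simp only [WeierstrassCurve.Affine.Point.zero_def, true_or, iff_true]
    exact ⟨AddSubgroup.zero_mem _, fun ℓ => AddSubgroup.zero_mem _⟩
  · rw [some_mem_kernelOfReductionAt_iff]
    constructor
    · rintro ⟨hx, hns⟩
      refine Or.inr ⟨hx, (W.inSigmaDisc_of_one_lt_norm hp h hx).2, fun ℓ hℓ => ?_⟩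
      haveI : Fact ℓ.Prime := ⟨hℓ⟩
      exact (mem_nonsingularReductionSubgroupAt_iff _).mp (hns ⟨ℓ, hℓ⟩)
    · rintro (h0 | ⟨hx, -, hns⟩)
      · exact (WeierstrassCurve.Affine.Point.some_ne_zero h h0).elim
      · exact ⟨hx, fun ℓ => by
          haveI : Fact ℓ.1.Prime := ⟨ℓ.2⟩
          exact (mem_nonsingularReductionSubgroupAt_iff _).mpr (hns ℓ.1 ℓ.2)⟩

end Locus

/-! ### The canonical sigma function does not vanish on `E₁(ℚ_p) ∖ {O}` -/

section Sigma

open PowerSeries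

variable {p : ℕ} [Fact p.Prime] (V : WeierstrassCurve ℚ_[p])

/-- `σ_p ∈ ℤ_p⟦t⟧` unconditionally (for the Mazur–Tate pair by definition, and for the junk value
`t`). [Mazur–Stein–Tate 2006, Thm. 1.3] [folklore] -/
theorem norm_coeff_padicSigma_le (n : ℕ) : ‖coeff n V.padicSigma‖ ≤ 1 := by
  unfold padicSigma mazurTatePair
  split_ifs with h
  · exact h.choose_spec.norm_coeff_le n
  · rw [coeff_X]
    split_ifs <;> simp

/-- `σ_p = t + O(t²)` unconditionally. [Mazur–Stein–Tate 2006, Thm. 1.3] [folklore] -/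
theorem coeff_one_padicSigma : coeff 1 V.padicSigma = 1 := by
  unfold padicSigma mazurTatePair
  split_ifs with h
  · exact h.choose_spec.coeff_one_eq
  · simp [coeff_X]

/-- `σ_p(0) = 0` unconditionally. [Mazur–Stein–Tate 2006, Thm. 1.3] [folklore] -/
theorem coeff_zero_padicSigma : coeff 0 V.padicSigma = 0 := by
  unfold padicSigma mazurTatePair
  split_ifs with h
  · rw [coeff_zero_eq_constantCoeff]; exact h.choose_spec.constantCoeff_eq
  · simp [coeff_X]

/-- The sigma series converges on the open unit disc (coefficients in `ℤ_p`).
[Mazur–Stein–Tate 2006, Thm. 1.3; Stein–Wuthrich 2013, §4] [folklore] -/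
theorem summable_padicSigma {t : ℚ_[p]} (ht : ‖t‖ < 1) :
    Summable fun n : ℕ => coeff n V.padicSigma * t ^ n := by
  refine Summable.of_norm_bounded (summable_geometric_of_lt_one (norm_nonneg t) ht) fun n => ?_
  rw [norm_mul, norm_pow]
  exact mul_le_of_le_one_left (pow_nonneg (norm_nonneg t) n) (V.norm_coeff_padicSigma_le n)

variable (W : WeierstrassCurve ℚ) (p)

/-- **`‖σ_p(t) - t‖ < ‖t‖` for `0 < ‖t‖ < 1`** (`σ_p = t + Σ_{n ≥ 2} cₙ tⁿ` with `cₙ ∈ ℤ_p`, and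
the ultrametric inequality); in particular `σ_p(t) ≠ 0` and `‖σ_p(t)‖ = ‖t‖`.
[Mazur–Stein–Tate 2006, Thm. 1.3 (`σ(t) = t + ⋯ ∈ tℤ_p⟦t⟧`)] [folklore] -/
theorem norm_padicSigmaEval_sub_lt {t : ℚ_[p]} (ht0 : t ≠ 0) (ht : ‖t‖ < 1) :
    ‖W.padicSigmaEval p t - t‖ < ‖t‖ := by
  have hsum := (W.baseChange ℚ_[p]).summable_padicSigma ht
  unfold padicSigmaEval
  rw [hsum.tsum_eq_zero_add, (summable_nat_add_iff 1 |>.mpr hsum).tsum_eq_zero_add]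
  simp only [coeff_zero_padicSigma, zero_mul, zero_add, coeff_one_padicSigma, one_mul, pow_one,
    add_sub_cancel_left]
  have hbound : ∀ n : ℕ, ‖coeff (n + 1 + 1) (W.baseChange ℚ_[p]).padicSigma * t ^ (n + 1 + 1)‖ ≤
      ‖t‖ ^ 2 := fun n => by
    rw [norm_mul, norm_pow]
    calc ‖coeff (n + 1 + 1) (W.baseChange ℚ_[p]).padicSigma‖ * ‖t‖ ^ (n + 1 + 1)
        ≤ 1 * ‖t‖ ^ (n + 1 + 1) := by
          gcongr; exact norm_coeff_padicSigma_le _ _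
      _ ≤ ‖t‖ ^ 2 := by
          rw [one_mul]
          exact pow_le_pow_of_le_one (norm_nonneg t) ht.le (by omega)
  refine lt_of_le_of_lt (IsUltrametricDist.norm_tsum_le_of_forall_le hbound) ?_
  rw [sq]
  exact mul_lt_of_lt_one_left (norm_pos_iff.mpr ht0) ht

/-- **`σ_p(t) ≠ 0` for `0 < ‖t‖ < 1`.** [Mazur–Stein–Tate 2006, Thm. 1.3] [folklore] -/
theorem padicSigmaEval_ne_zero {t : ℚ_[p]} (ht0 : t ≠ 0) (ht : ‖t‖ < 1) :
    W.padicSigmaEval p t ≠ 0 := by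
  intro h0
  have := W.norm_padicSigmaEval_sub_lt p ht0 ht
  rw [h0, zero_sub, norm_neg] at this
  exact lt_irrefl _ this

/-- **`σ_p(P) ≠ 0` for `P ∈ E(ℚ) ∩ E₁(ℚ_p)`, `p` odd** (`ℤ`-integral equation): `z(P) = -x/y` lies
in the punctured open unit disc. [Mazur–Stein–Tate 2006, §2.3 ("`σ_v` as a mapping from `E₁(K_v)`
to `K_v^*`")] [folklore] -/
theorem padicSigmaAt_ne_zero [W.IsIntegral ℤ] (hp : p ≠ 2) {x y : ℚ} (h : W.toAffine.Nonsingular x y)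
    (hx : 1 < ‖(x : ℚ_[p])‖) : W.padicSigmaAt p (.some x y h) ≠ 0 := by
  obtain ⟨hy, hdisc⟩ := W.inSigmaDisc_of_one_lt_norm hp h hx
  have hx0 : (x : ℚ_[p]) ≠ 0 := by
    rintro h0; rw [h0, norm_zero] at hx; exact not_lt.mpr zero_le_one hx
  have hz0 : -(x : ℚ_[p]) / y ≠ 0 := div_ne_zero (neg_ne_zero.mpr hx0) hy
  have hz1 : ‖-(x : ℚ_[p]) / y‖ < 1 := by
    refine lt_trans hdisc ?_
    have hp1 : (1 : ℝ) < p := by exact_mod_cast (Fact.out : p.Prime).one_lt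
    calc (p : ℝ) ^ (-(1 / ((p : ℝ) - 1))) < (p : ℝ) ^ (0 : ℝ) := by
          rw [Real.rpow_lt_rpow_left_iff hp1, neg_lt_zero]
          exact div_pos one_pos (by linarith)
      _ = 1 := Real.rpow_zero _
  exact W.padicSigmaEval_ne_zero p hz0 hz1

end Sigma

end WeierstrassCurve

namespace Literature.NumberTheory.EllipticCurves

/-! ### Generic pairs: distinct `x`-coordinates -/

section Generic

variable {F : Type*} [Field F] [DecidableEq F] {V : WeierstrassCurve F}

/-- If `P ± Q ≠ O` then `x(P) ≠ x(Q)` (two affine points with the same `x`-coordinate are equal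
or opposite). [Silverman AEC III.2.3] [folklore] -/
theorem X_ne_of_sub_ne_zero_of_add_ne_zero {x₁ y₁ x₂ y₂ : F} (h₁ : V.toAffine.Nonsingular x₁ y₁)
    (h₂ : V.toAffine.Nonsingular x₂ y₂)
    (hsub : (.some x₁ y₁ h₁ : V.toAffine.Point) - .some x₂ y₂ h₂ ≠ 0)
    (hadd : (.some x₁ y₁ h₁ : V.toAffine.Point) + .some x₂ y₂ h₂ ≠ 0) : x₁ ≠ x₂ := by
  intro hx
  by_cases hy : y₁ = V.toAffine.negY x₂ y₂
  · exact hadd (WeierstrassCurve.Affine.Point.add_of_Y_eq hx hy)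
  · have hyy := WeierstrassCurve.Affine.Y_eq_of_Y_ne h₁.1 h₂.1 hx hy
    subst hx hyy
    exact hsub (sub_self _)

end Generic

end Literature.NumberTheory.EllipticCurves

namespace WeierstrassCurve

open Literature.NumberTheory.EllipticCurves

/-! ### The global denominator identity from Néron's local law at every prime -/

section Denominators

/-- **`den x(P+Q) · den x(P-Q) = den x(P)² · den x(Q)² · (x(P) - x(Q))²`** for a generic pair of
rational points all four of which reduce non-singularly modulo every prime: the product over all
primes `ℓ` of (the exponential of) the local law `padicValNat_den_parallelogram`, i.e. the sum of
Néron's quasi-parallelogram laws at the finite places (a positive rational number is determined by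
its valuations). [Silverman ATAEC VI.4.1 and Ex. 6.3 (local law); Mazur–Stein–Tate 2006, §2.6
(sum over all places)] [folklore] -/
theorem den_mul_den_eq (hden : padicValNat_den_parallelogram) (W : WeierstrassCurve ℚ) [W.IsElliptic]
    [W.IsIntegral ℤ] {x₁ y₁ x₂ y₂ x₃ y₃ x₄ y₄ : ℚ} (h₁ : W.toAffine.Nonsingular x₁ y₁)
    (h₂ : W.toAffine.Nonsingular x₂ y₂) (h₃ : W.toAffine.Nonsingular x₃ y₃)
    (h₄ : W.toAffine.Nonsingular x₄ y₄) (hx : x₁ ≠ x₂)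
    (hS : (.some x₁ y₁ h₁ : W.toAffine.Point) + .some x₂ y₂ h₂ = .some x₃ y₃ h₃)
    (hD : (.some x₁ y₁ h₁ : W.toAffine.Point) - .some x₂ y₂ h₂ = .some x₄ y₄ h₄)
    (hns : ∀ ℓ : ℕ, ℓ.Prime → W.HasNonsingularReductionAt ℓ x₁ y₁ ∧ W.HasNonsingularReductionAt ℓ x₂ y₂ ∧
      W.HasNonsingularReductionAt ℓ x₃ y₃ ∧ W.HasNonsingularReductionAt ℓ x₄ y₄) :
    ((x₃.den * x₄.den : ℕ) : ℚ) = (x₁.den : ℚ) ^ 2 * (x₂.den : ℚ) ^ 2 * (x₁ - x₂) ^ 2 := by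
  have hδ0 : x₁ - x₂ ≠ 0 := sub_ne_zero.mpr hx
  have hnum : (x₁ - x₂).num ≠ 0 := Rat.num_ne_zero.mpr hδ0
  have hnumabs : (x₁ - x₂).num.natAbs ≠ 0 := Int.natAbs_ne_zero.mpr hnum
  -- the identity of natural numbers, prime by prime
  have hnat : x₃.den * x₄.den * (x₁ - x₂).den ^ 2 =
      x₁.den ^ 2 * x₂.den ^ 2 * (x₁ - x₂).num.natAbs ^ 2 := by
    refine (Nat.eq_iff_prime_padicValNat_eq _ _ ?_ ?_).mpr fun ℓ hℓ => ?_
    · exact Nat.mul_ne_zero (Nat.mul_ne_zero x₃.den_nz x₄.den_nz) (pow_ne_zero 2 (x₁ - x₂).den_nz)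
    · exact Nat.mul_ne_zero (Nat.mul_ne_zero (pow_ne_zero 2 x₁.den_nz) (pow_ne_zero 2 x₂.den_nz))
        (pow_ne_zero 2 hnumabs)
    haveI : Fact ℓ.Prime := ⟨hℓ⟩
    obtain ⟨hn₁, hn₂, hn₃, hn₄⟩ := hns ℓ hℓ
    have hloc := hden W ℓ h₁ h₂ hx hn₁ hn₂ (by rw [hS]; exact hn₃) (by rw [hD]; exact hn₄)
    rw [hS, hD, xCoord_some, xCoord_some, padicValRat_def] at hloc
    rw [padicValNat.mul (Nat.mul_ne_zero x₃.den_nz x₄.den_nz) (pow_ne_zero 2 (x₁ - x₂).den_nz),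
      padicValNat.mul x₃.den_nz x₄.den_nz, padicValNat.pow,
      padicValNat.mul (Nat.mul_ne_zero (pow_ne_zero 2 x₁.den_nz) (pow_ne_zero 2 x₂.den_nz))
        (pow_ne_zero 2 hnumabs),
      padicValNat.mul (pow_ne_zero 2 x₁.den_nz) (pow_ne_zero 2 x₂.den_nz),
      padicValNat.pow, padicValNat.pow, padicValNat.pow]
    have hvi : (padicValInt ℓ (x₁ - x₂).num : ℤ) = padicValNat ℓ (x₁ - x₂).num.natAbs := by
      simp [padicValInt]
    rw [hvi] at hloc
    omega
  -- back to `ℤ`, then `ℚ`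
  have hint : ((x₃.den * x₄.den : ℕ) : ℤ) * ((x₁ - x₂).den : ℤ) ^ 2 =
      (x₁.den : ℤ) ^ 2 * (x₂.den : ℤ) ^ 2 * (x₁ - x₂).num ^ 2 := by
    have h := congrArg (fun n : ℕ => (n : ℤ)) hnat
    simp only [Nat.cast_mul, Nat.cast_pow, Int.natCast_natAbs, sq_abs] at h
    simpa only [Nat.cast_mul] using h
  have hcast : ((x₃.den * x₄.den : ℕ) : ℚ) * ((x₁ - x₂).den : ℚ) ^ 2 =
      (x₁.den : ℚ) ^ 2 * (x₂.den : ℚ) ^ 2 * ((x₁ - x₂).num : ℚ) ^ 2 := by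
    exact_mod_cast hint
  rw [← Rat.mul_den_eq_num (x₁ - x₂), mul_pow, ← mul_assoc] at hcast
  exact mul_right_cancel₀ (pow_ne_zero 2 (Nat.cast_ne_zero.mpr (x₁ - x₂).den_nz)) hcast

end Denominators

end WeierstrassCurve

/-! ### `log_p(-1) = 0` and friends (from the tree's theorem `padicLog_mul_holds`) -/

namespace Literature.NumberTheory.EllipticCurves

variable (p : ℕ) [Fact p.Prime]

/-- `log_p 1 = 0`, from multiplicativity (`padicLog_mul_holds`). [Iwasawa 1972, §4.4] [folklore] -/
theorem padicLog_one : padicLog p 1 = 0 := by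
  have h1 := padicLog_mul_holds p one_ne_zero one_ne_zero
  rw [mul_one] at h1
  linear_combination -h1

/-- `log_p (-1) = 0` (`2 log_p(-1) = log_p 1 = 0`). [Iwasawa 1972, §4.4] [folklore] -/
theorem padicLog_neg_one : padicLog p (-1) = 0 := by
  have h1 := padicLog_mul_holds p (neg_ne_zero.mpr one_ne_zero) (neg_ne_zero.mpr one_ne_zero)
  rw [neg_mul_neg, mul_one, padicLog_one] at h1
  linear_combination -(1 / 2 : ℚ_[p]) * h1

variable {p} in
/-- `log_p (-a) = log_p a`. [Iwasawa 1972, §4.4] [folklore] -/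
theorem padicLog_neg {a : ℚ_[p]} (ha : a ≠ 0) : padicLog p (-a) = padicLog p a := by
  rw [← neg_one_mul, padicLog_mul_holds p (neg_ne_zero.mpr one_ne_zero) ha, padicLog_neg_one,
    zero_add]

variable {p} in
/-- `log_p (a²) = 2 log_p a`. [Iwasawa 1972, §4.4] [folklore] -/
theorem padicLog_sq {a : ℚ_[p]} (ha : a ≠ 0) : padicLog p (a ^ 2) = 2 * padicLog p a := by
  rw [sq, padicLog_mul_holds p ha ha, two_mul]

end Literature.NumberTheory.EllipticCurves

namespace WeierstrassCurve

open Literature.NumberTheory.EllipticCurves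

/-! ### The assembly: the parallelogram law of the sigma formula on generic admissible pairs -/

/-- **The sigma formula satisfies the parallelogram law on generic admissible pairs**
(`canonicalPAdicHeight_parallelogram`, Mazur–Stein–Tate 2006 §2.7: "`h_ρ` is quadratic because of
property IV of `σ`"), PROVED from the inputs of the printed argument: the theta relation of `σ_p`
on the kernel of reduction (`padicSigma_theta`, MT 1991 / Blakestad–Grant 2023 Prop. 14), Néron's
local denominator law at every prime (`padicValNat_den_parallelogram`, ATAEC VI.4.1 + Ex. 6.3) and
the multiplicativity of the Iwasawa logarithm (the tree's theorem `padicLog_mul_holds`, Iwasawa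
1972 §4.4); the remaining ingredients — the admissible locus is a subgroup for odd `p`
(`exists_addSubgroup_coe_eq_localConditionsLocus`, AEC VII.2.1–2.2), `σ_p(P) ≠ 0` on `E₁(ℚ_p)`
(`padicSigmaAt_ne_zero`) and the global denominator identity (`den_mul_den_eq`) — are proved in this
file. Computation: with `dᵢ = den x(Pᵢ)`, `σᵢ = σ_p(Pᵢ)` for `P₁ = P, P₂ = Q, P₃ = P + Q, P₄ = P - Q`
and `δ = x(P) - x(Q)`: `d₃d₄ = d₁²d₂²δ²`, `σ₃σ₄ = -δσ₁²σ₂²`, so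
`ĥ(P+Q) + ĥ(P-Q) = log_p(d₃d₄) - 2log_p(σ₃σ₄) = 2ĥ(P) + 2ĥ(Q)` as `log_p(-1) = 0`.
[Mazur–Stein–Tate 2006, §2.6–2.7; Stein–Wuthrich 2013, §4.1 eq. (4.1)]
[cite: MazurSteinTate2006, §2.7] -/
theorem canonicalPAdicHeight_parallelogram_of_theta
    (hθ : padicSigma_theta) (hden : padicValNat_den_parallelogram) :
    canonicalPAdicHeight_parallelogram := by
  intro W _ _ p _ hp hgood hord P Q hP hQ hsub hadd
  have hp2 : p ≠ 2 := by omega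
  have hmul : padicLog_mul p := padicLog_mul_holds p
  -- the subgroup: `P ± Q` again satisfy the local conditions
  obtain ⟨H, hH⟩ := W.exists_addSubgroup_coe_eq_localConditionsLocus p hp2
  have hmem : ∀ R, R ∈ H ↔ R = 0 ∨ W.SatisfiesLocalConditions p R := fun R => by
    rw [← SetLike.mem_coe, hH]; rfl
  have hPH : P ∈ H := (hmem P).mpr (Or.inr hP)
  have hQH : Q ∈ H := (hmem Q).mpr (Or.inr hQ)
  have hS' : W.SatisfiesLocalConditions p (P + Q) := ((hmem _).mp (H.add_mem hPH hQH)).resolve_left hadd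
  have hD' : W.SatisfiesLocalConditions p (P - Q) := ((hmem _).mp (H.sub_mem hPH hQH)).resolve_left hsub
  -- coordinates of the four points
  rcases P with _ | ⟨x₁, y₁, h₁⟩
  · exact (W.not_satisfiesLocalConditions_zero p hP).elim
  rcases Q with _ | ⟨x₂, y₂, h₂⟩
  · exact (W.not_satisfiesLocalConditions_zero p hQ).elim
  have hx : x₁ ≠ x₂ := X_ne_of_sub_ne_zero_of_add_ne_zero h₁ h₂ hsub hadd
  rcases hS : (.some x₁ y₁ h₁ : W.toAffine.Point) + .some x₂ y₂ h₂ with _ | ⟨x₃, y₃, h₃⟩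
  · exact (hadd hS).elim
  rcases hD : (.some x₁ y₁ h₁ : W.toAffine.Point) - .some x₂ y₂ h₂ with _ | ⟨x₄, y₄, h₄⟩
  · exact (hsub hD).elim
  rw [hS] at hS'
  rw [hD] at hD'
  obtain ⟨hx₁, -, hns₁⟩ := hP
  obtain ⟨hx₂, -, hns₂⟩ := hQ
  obtain ⟨hx₃, -, hns₃⟩ := hS'
  obtain ⟨hx₄, -, hns₄⟩ := hD'
  -- the theta relation and the denominator identity
  have hθ' := hθ W p hp hgood hord h₁ h₂ hx₁ hx₂ hx
  rw [hS, hD] at hθ'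
  have hden' := den_mul_den_eq hden W h₁ h₂ h₃ h₄ hx hS hD
    fun ℓ hℓ => ⟨hns₁ ℓ hℓ, hns₂ ℓ hℓ, hns₃ ℓ hℓ, hns₄ ℓ hℓ⟩
  have hdenp : ((x₃.den : ℚ) : ℚ_[p]) * ((x₄.den : ℚ) : ℚ_[p]) =
      ((x₁.den : ℚ) : ℚ_[p]) ^ 2 * ((x₂.den : ℚ) : ℚ_[p]) ^ 2 * ((x₁ : ℚ_[p]) - x₂) ^ 2 := by
    have := congrArg (fun q : ℚ => (q : ℚ_[p])) hden'
    push_cast at this ⊢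
    exact this
  -- non-vanishing
  have hσ₁ := W.padicSigmaAt_ne_zero p hp2 h₁ hx₁
  have hσ₂ := W.padicSigmaAt_ne_zero p hp2 h₂ hx₂
  have hσ₃ := W.padicSigmaAt_ne_zero p hp2 h₃ hx₃
  have hσ₄ := W.padicSigmaAt_ne_zero p hp2 h₄ hx₄
  have hd : ∀ x : ℚ, ((x.den : ℚ) : ℚ_[p]) ≠ 0 := fun x => by exact_mod_cast x.den_nz
  have hδ : (x₁ : ℚ_[p]) - x₂ ≠ 0 := sub_ne_zero.mpr (by exact_mod_cast hx)
  -- logarithms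
  have hlogd : padicLog p ((x₃.den : ℚ) : ℚ_[p]) + padicLog p ((x₄.den : ℚ) : ℚ_[p]) =
      2 * padicLog p ((x₁.den : ℚ) : ℚ_[p]) + 2 * padicLog p ((x₂.den : ℚ) : ℚ_[p]) +
        2 * padicLog p ((x₁ : ℚ_[p]) - x₂) := by
    rw [← hmul (hd x₃) (hd x₄), hdenp, hmul (mul_ne_zero (pow_ne_zero 2 (hd x₁))
      (pow_ne_zero 2 (hd x₂))) (pow_ne_zero 2 hδ), hmul (pow_ne_zero 2 (hd x₁))
      (pow_ne_zero 2 (hd x₂)), padicLog_sq (hd x₁), padicLog_sq (hd x₂), padicLog_sq hδ]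
  have hlogσ : padicLog p (W.padicSigmaAt p (.some x₃ y₃ h₃)) +
      padicLog p (W.padicSigmaAt p (.some x₄ y₄ h₄)) =
        padicLog p ((x₁ : ℚ_[p]) - x₂) + 2 * padicLog p (W.padicSigmaAt p (.some x₁ y₁ h₁)) +
          2 * padicLog p (W.padicSigmaAt p (.some x₂ y₂ h₂)) := by
    have hδ' : (x₂ : ℚ_[p]) - x₁ ≠ 0 := by rw [← neg_sub]; exact neg_ne_zero.mpr hδ
    rw [← hmul hσ₃ hσ₄, hθ', hmul (mul_ne_zero hδ' (pow_ne_zero 2 hσ₁)) (pow_ne_zero 2 hσ₂),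
      hmul hδ' (pow_ne_zero 2 hσ₁), padicLog_sq hσ₁, padicLog_sq hσ₂, ← neg_sub, padicLog_neg hδ]
  rw [hS, hD]
  simp only [canonicalPAdicHeight_some]
  linear_combination hlogd - 2 * hlogσ

/-- **Existence of the canonical `p`-adic height datum from the analytic inputs**: the theta
relation of `σ_p` (`padicSigma_theta`), Néron's local denominator law
(`padicValNat_den_parallelogram`) and the torsion-freeness of `E₁(ℚ_p)` for odd `p`
(`not_isOfFinAddOrder_of_one_lt_padicNorm`); the subgroup property of the admissible locus (`localConditionsLocus_isAddSubgroup` for odd `p`) and the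
parallelogram law (`canonicalPAdicHeight_parallelogram`) are now theorems, and the algebraic half is
`exists_isCanonical_of_parallelogram` of `CanonicalPAdicHeightProofs.lean`.
[Mazur–Stein–Tate 2006, §1 ("extends uniquely"), §2.6–2.7; Stein–Wuthrich 2013, §4.1 eq. (4.1)]
[cite: MazurSteinTate2006, §2.7] -/
theorem exists_isCanonical_of_theta (htf : not_isOfFinAddOrder_of_one_lt_padicNorm)
    (hθ : padicSigma_theta) (hden : padicValNat_den_parallelogram) : exists_isCanonical := by
  intro W _ _ p _ hp hgood hord
  have hpar := canonicalPAdicHeight_parallelogram_of_theta hθ hden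
  obtain ⟨H, hH⟩ := W.exists_addSubgroup_coe_eq_localConditionsLocus p (by omega)
  have hmem : ∀ P, P ∈ H ↔ P = 0 ∨ W.SatisfiesLocalConditions p P := fun P => by
    rw [← SetLike.mem_coe, hH]; rfl
  have hslc : ∀ P ∈ H, P ≠ 0 → W.SatisfiesLocalConditions p P := fun P hP h0 =>
    ((hmem P).mp hP).resolve_left h0
  -- `H` is torsion-free
  have htf' : ∀ P ∈ H, IsOfFinAddOrder P → P = 0 := by
    intro P hP hfin
    by_contra h0
    have hP' := hslc P hP h0
    cases P with
    | zero => exact h0 rfl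
    | some x y h => exact htf W p (by omega) h hP'.1 hfin
  -- the full parallelogram law on `H`
  have hfull := Literature.NumberTheory.EllipticCurves.parallelogram_of_generic H htf'
    (W.canonicalPAdicHeight p) rfl fun P hP Q hQ hP0 hQ0 hPQ hPQ' =>
      hpar W p hp hgood hord P Q (hslc P hP hP0) (hslc Q hQ hQ0) hPQ hPQ'
  obtain ⟨B, hsymm, htors, hdiag⟩ :=
    Literature.NumberTheory.EllipticCurves.exists_pairing_of_parallelogram H _ hfull
  exact ⟨⟨B, hsymm, fun P Q hP => htors P Q hP⟩, fun P hP => hdiag P ((hmem P).mpr (Or.inr hP.2))⟩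

/-- The same with uniqueness, given admissible multiples (`exists_admissible_nsmul`).
[Mazur–Stein–Tate 2006, §1 ("extends uniquely")] [folklore] -/
theorem existsUnique_isCanonical_of_theta (htf : not_isOfFinAddOrder_of_one_lt_padicNorm)
    (hθ : padicSigma_theta) (hden : padicValNat_den_parallelogram) (hS : exists_admissible_nsmul)
    (W : WeierstrassCurve ℚ) [W.IsElliptic] [W.IsGloballyMinimal] (p : ℕ) [Fact p.Prime]
    (hp : 5 ≤ p) (hgood : W.HasGoodReductionAtPrime p) (hord : ¬ (p : ℤ) ∣ W.frobeniusTrace p) :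
    ∃! D : PAdicHeightData W p, D.IsCanonical := by
  obtain ⟨D, hD⟩ := exists_isCanonical_of_theta htf hθ hden W p hp hgood hord
  exact ⟨D, hD, fun D' hD' => PAdicHeightData.isCanonical_unique (hS W p) hD' hD⟩

end WeierstrassCurve
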